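import Summits.AnomalousDissipation.AnomalousDissipation.Theorems.SawtoothPulseCascadeK1LocalisedCascadeKHSheetSigmaTable
import Summits.AnomalousDissipation.AnomalousDissipation.Theorems.SawtoothPulseCascadeK1LocalisedCascadeKHRateClosedForm

/-!
# K2 lane (route-2 `SawtoothPulseCascade`, crux dir `K1LocalisedCascade`): S2 table — the D-form of the trace weight and the BAND LEMMA

Helper file of the K2 lane (S2 certificate recipe R1–R3 of memo `Cruxes/K1LocalisedCascade/K2SheetBlockPropagator.md`; ACL item
stmt-AnomalousDissipation-19491). Two facts turn the homogeneous S2 constant into a ONE-dimensional table in `k`: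
* `sheetW_eq_Dform`: the trace weight is `W = (π²/4)·(D(πk)² + cos²πβ)/(cosh²πk − cos²πβ)`, `D(x) = 2 sinh x/x − cosh x` — the twin of
  the closed form `σ² = ((πk)²/4)·(cos²πβ − D²)₊/(cosh²πk − cos²πβ)` (`sawSigma_sq_eq`); both are INCREASING in `cos²πβ`, so the Bloch phase
  `β = 0` dominates (`frac_le_frac_one`): `σ² ≤ (πk)²/4·(1 − D²)/sinh²πk`, `k²W ≤ (πk)²/4·(1 + D²)/sinh²πk`.
* `sheet_energy_le_on_band`: on a band `k ∈ [klo, khi]`, from certified brackets (`xlo ≤ π klo`, `π khi ≤ xhi`, `Clo ≤ cosh xlo`,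
  `D ∈ [Dlo, Dhi]` on the band) and rational side conditions (a band rate `σb` with `e^{8σb} ≤ U`, `U ≤ 2Tσb`, `8 ≤ T`, a band weight `Kw`,
  and `2((U+1)/2)² + 2T²Kw ≤ B²`), EVERY S2-stub solution on `[0, 8]` for EVERY Bloch phase obeys `khForm(q θ) ≤ B² khForm(q 0)`
  (through `sheet_energy_le_of_sigma_bound`, with `sinh(8σ) ≤ (σ/σb) sinh(8σb)` by convexity, termwise on the power series).
No definitions; no statement about the crux. [cite: Drazin2002, §8.3 (8.36)–(8.38) (Rayleigh jump conditions at the kinks of a broken-line profile)] [problem: turb]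
-/

-- `Summit.<Summit>.<Problem>`: single-conjunct summit, the duplicate namespace segment is deliberate.
set_option linter.dupNamespace false

noncomputable section

namespace Summit.AnomalousDissipation.AnomalousDissipation.Theorems.SawtoothPulseCascade.K2PhaseBudget

open Set Real Complex Literature.Analysis.FluidPDE.SawtoothCascade

/-! ## §1 The D-form of the trace weight -/

/-- **D-form of the trace weight:** `½(F₋²ρ + F₊²/ρ) = (π²/4)(D(πk)² + cos²πβ)/(cosh²πk − cos²πβ)`, `D(x) = 2 sinh x/x − cosh x`.
[cite: Drazin2002, §8.3 (8.36)–(8.38)] -/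
theorem sheetW_eq_Dform {k : ℝ} (hk : 0 < k) (β : ℝ) :
    ((π / 2 - Real.sinh (π * k) / (k * (Real.cosh (π * k) - |Real.cos (π * β)|))) ^ 2 *
          ((Real.cosh (π * k) - |Real.cos (π * β)|) / (Real.cosh (π * k) + |Real.cos (π * β)|)) +
        (π / 2 - Real.sinh (π * k) / (k * (Real.cosh (π * k) + |Real.cos (π * β)|))) ^ 2 *
          ((Real.cosh (π * k) + |Real.cos (π * β)|) / (Real.cosh (π * k) - |Real.cos (π * β)|))) / 2 =
      π ^ 2 / 4 * ((2 * Real.sinh (π * k) / (π * k) - Real.cosh (π * k)) ^ 2 + Real.cos (π * β) ^ 2) /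
        (Real.cosh (π * k) ^ 2 - Real.cos (π * β) ^ 2) := by
  have hx : 0 < π * k := by positivity
  have hC1 : 1 < Real.cosh (π * k) := Real.one_lt_cosh.2 hx.ne'
  have hγ1 : |Real.cos (π * β)| ≤ 1 := Real.abs_cos_le_one _
  have hγ0 : 0 ≤ |Real.cos (π * β)| := abs_nonneg _
  have hm : Real.cosh (π * k) - |Real.cos (π * β)| ≠ 0 := by
    have : 0 < Real.cosh (π * k) - |Real.cos (π * β)| := by linarith
    exact this.ne'
  have hp : Real.cosh (π * k) + |Real.cos (π * β)| ≠ 0 := by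
    have : 0 < Real.cosh (π * k) + |Real.cos (π * β)| := by linarith
    exact this.ne'
  have hk0 : k ≠ 0 := hk.ne'
  have hπ : π ≠ 0 := Real.pi_ne_zero
  rw [← sq_abs (Real.cos (π * β))]
  have hden : Real.cosh (π * k) ^ 2 - |Real.cos (π * β)| ^ 2 ≠ 0 := by
    have : Real.cosh (π * k) ^ 2 - |Real.cos (π * β)| ^ 2 =
        (Real.cosh (π * k) - |Real.cos (π * β)|) * (Real.cosh (π * k) + |Real.cos (π * β)|) := by ring
    rw [this]; exact mul_ne_zero hm hp
  have hx0 : π * k ≠ 0 := hx.ne'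
  field_simp
  ring

/-- Monotonicity in the Bloch variable: for `t ≤ 1 < C²` and any `d`, `(t − d)/(C² − t) ≤ (1 − d)/(C² − 1)` and
`(t + d)/(C² − t) ≤ (1 + d)/(C² − 1)` provided `0 ≤ C² − d` resp. `0 ≤ C² + d` (the numerators' growth). [folklore] -/
theorem frac_le_frac_one {t d C2 : ℝ} (ht : t ≤ 1) (hC : 1 < C2) (hd : d ≤ C2) :
    (t - d) / (C2 - t) ≤ (1 - d) / (C2 - 1) ∧ ((-C2 ≤ d) → (t + d) / (C2 - t) ≤ (1 + d) / (C2 - 1)) := by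
  have h1 : 0 < C2 - t := by linarith
  have h2 : 0 < C2 - 1 := by linarith
  constructor
  · rw [div_le_div_iff₀ h1 h2]; nlinarith
  · intro hd'; rw [div_le_div_iff₀ h1 h2]; nlinarith

/-! ## §2 Band bounds for `σ` and `k²W` (opaque-variable real lemmas) -/

/-- Real-variable core for `σ`: with `x² ≤ X`, `1 < Clo² ≤ C2`, `d ≤ C2`, `mD ≤ d`, `t ≤ 1` and the check
`X(1 − mD)/4 ≤ σb²(Clo² − 1)`: `max 0 (x²/4·(t − d)/(C2 − t)) ≤ σb²`. [folklore] -/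
theorem sigma_core {x2 X t d C2 Clo2 mD σb : ℝ} (hx2 : 0 ≤ x2) (hX : x2 ≤ X) (ht : t ≤ 1) (hC : 1 < Clo2) (hCC : Clo2 ≤ C2)
    (hd : d ≤ C2) (hmD : mD ≤ d) (hcheck : X / 4 * (1 - mD) ≤ σb ^ 2 * (Clo2 - 1)) :
    max 0 (x2 / 4 * (t - d) / (C2 - t)) ≤ σb ^ 2 := by
  apply max_le (sq_nonneg _)
  have hC2 : 1 < C2 := lt_of_lt_of_le hC hCC
  have hstep := (frac_le_frac_one ht hC2 hd).1
  have hE : x2 / 4 * (t - d) / (C2 - t) ≤ x2 / 4 * ((1 - d) / (C2 - 1)) := by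
    rw [mul_div_assoc]; exact mul_le_mul_of_nonneg_left hstep (by positivity)
  refine hE.trans ?_
  have hC0 : 0 < Clo2 - 1 := by linarith
  rcases le_or_gt (1 - d) 0 with hneg | hpos
  · have : x2 / 4 * ((1 - d) / (C2 - 1)) ≤ 0 :=
      mul_nonpos_of_nonneg_of_nonpos (by positivity) (div_nonpos_of_nonpos_of_nonneg hneg (by linarith))
    exact this.trans (sq_nonneg _)
  · calc x2 / 4 * ((1 - d) / (C2 - 1)) ≤ X / 4 * ((1 - mD) / (Clo2 - 1)) := by
          have hb : (1 - d) / (C2 - 1) ≤ (1 - mD) / (Clo2 - 1) :=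
            div_le_div₀ (by linarith) (by linarith) hC0 (by linarith)
          have hb0 : 0 ≤ (1 - d) / (C2 - 1) := div_nonneg hpos.le (by linarith)
          exact mul_le_mul (by linarith) hb hb0 (by linarith)
      _ = X / 4 * (1 - mD) / (Clo2 - 1) := by ring
      _ ≤ σb ^ 2 := by rw [div_le_iff₀ hC0]; exact hcheck

/-- Real-variable core for `k²W`: `x²/4·(t + d)/(C2 − t) ≤ Kw` under the analogous band data and `X(1 + MD)/4 ≤ Kw(Clo² − 1)`. [folklore] -/
theorem k2W_core {x2 X t d C2 Clo2 MD Kw : ℝ} (hx2 : 0 ≤ x2) (hX : x2 ≤ X) (ht : t ≤ 1) (hC : 1 < Clo2) (hCC : Clo2 ≤ C2)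
    (hd0 : 0 ≤ d) (hd : d ≤ C2) (hMD : d ≤ MD) (hcheck : X / 4 * (1 + MD) ≤ Kw * (Clo2 - 1)) :
    x2 / 4 * ((t + d) / (C2 - t)) ≤ Kw := by
  have hC2 : 1 < C2 := lt_of_lt_of_le hC hCC
  have hstep := (frac_le_frac_one ht hC2 hd).2 (by linarith)
  have hC0 : 0 < Clo2 - 1 := by linarith
  calc x2 / 4 * ((t + d) / (C2 - t)) ≤ x2 / 4 * ((1 + d) / (C2 - 1)) := mul_le_mul_of_nonneg_left hstep (by positivity)
    _ ≤ X / 4 * ((1 + MD) / (Clo2 - 1)) := by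
        have hb : (1 + d) / (C2 - 1) ≤ (1 + MD) / (Clo2 - 1) :=
          div_le_div₀ (by linarith) (by linarith) hC0 (by linarith)
        have hb0 : 0 ≤ (1 + d) / (C2 - 1) := div_nonneg (by linarith) (by linarith)
        exact mul_le_mul (by linarith) hb hb0 (by linarith)
    _ = X / 4 * (1 + MD) / (Clo2 - 1) := by ring
    _ ≤ Kw := by rw [div_le_iff₀ hC0]; exact hcheck

/-- Rate bookkeeping on a band: from `0 ≤ σ ≤ σb`, `e^{8σb} ≤ U ≤ 2Tσb`:
`sinh(8σ) ≤ Tσ` (concavity from below: `sinh(a y) ≤ a sinh y`) and `cosh(8σ)² ≤ ((U+1)/2)²`. [folklore] -/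
theorem sinh_cosh_band {σ σb U T : ℝ} (hσ0 : 0 ≤ σ) (hσle : σ ≤ σb) (hσb : 0 < σb)
    (hU : Real.exp (8 * σb) ≤ U) (hTU : U ≤ 2 * T * σb) :
    Real.sinh (8 * σ) ≤ T * σ ∧ Real.cosh (8 * σ) ^ 2 ≤ ((U + 1) / 2) ^ 2 := by
  have hem : Real.exp (-(8 * σb)) ≤ 1 := by rw [Real.exp_le_one_iff]; linarith
  have hem0 := Real.exp_pos (-(8 * σb))
  constructor
  · rcases hσ0.eq_or_lt with h0 | hpos
    · rw [← h0]; simp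
    · have ha0 : 0 ≤ σ / σb := div_nonneg hσ0 hσb.le
      have ha1 : σ / σb ≤ 1 := (div_le_one hσb).2 hσle
      have h1 : Real.sinh (8 * σ) = Real.sinh (σ / σb * (8 * σb)) := by congr 1; field_simp
      have h2 : Real.sinh (σ / σb * (8 * σb)) ≤ σ / σb * Real.sinh (8 * σb) := by
        -- termwise on the power series (instance of the tree's `sinh_mul_le_mul_sinh`, whose module is not built on this farm head)
        have e1 := Real.hasSum_sinh (σ / σb * (8 * σb))
        have e2 := (Real.hasSum_sinh (8 * σb)).mul_left (σ / σb)
        refine hasSum_le (fun n => ?_) e1 e2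
        have hpow : (σ / σb) ^ (2 * n + 1) ≤ σ / σb := by
          calc (σ / σb) ^ (2 * n + 1) = σ / σb * (σ / σb) ^ (2 * n) := by ring
            _ ≤ σ / σb * 1 := mul_le_mul_of_nonneg_left (pow_le_one₀ ha0 ha1) ha0
            _ = σ / σb := mul_one _
        calc (σ / σb * (8 * σb)) ^ (2 * n + 1) / ((2 * n + 1).factorial : ℝ)
            = (σ / σb) ^ (2 * n + 1) * ((8 * σb) ^ (2 * n + 1) / ((2 * n + 1).factorial : ℝ)) := by rw [mul_pow]; ring
          _ ≤ σ / σb * ((8 * σb) ^ (2 * n + 1) / ((2 * n + 1).factorial : ℝ)) :=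
              mul_le_mul_of_nonneg_right hpow (by positivity)
      have h3 : Real.sinh (8 * σb) ≤ U / 2 := by rw [Real.sinh_eq]; linarith
      have h4 : σ / σb * Real.sinh (8 * σb) ≤ σ / σb * (U / 2) := mul_le_mul_of_nonneg_left h3 ha0
      have h5 : σ / σb * (U / 2) ≤ σ / σb * (T * σb) := mul_le_mul_of_nonneg_left (by linarith) ha0
      have h6 : σ / σb * (T * σb) = T * σ := by field_simp
      linarith
  · have h1 : Real.cosh (8 * σ) ≤ Real.cosh (8 * σb) := by
      rw [Real.cosh_le_cosh, abs_of_nonneg (by linarith), abs_of_nonneg (by linarith)]; linarith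
    have h2 : Real.cosh (8 * σb) ≤ (U + 1) / 2 := by rw [Real.cosh_eq]; linarith
    exact pow_le_pow_left₀ (Real.cosh_pos _).le (h1.trans h2) 2

/-! ## §3 The band lemma -/

/-- **Band lemma (S2 table, recipe R1–R3).** On `k ∈ [klo, khi]` (`klo > 0`), for every Bloch phase `β` and every S2-stub solution `q`
of the sheet block on `[0, 8]`: `khForm(q θ) ≤ B²·khForm(q 0)`, given certified band data — `xlo ≤ π klo`, `π khi ≤ xhi`, `Clo ≤ cosh xlo`
(`Clo > 1`), `D xhi ≥ Dlo`, `D xlo ≤ Dhi`, a lower bound `mD ≤ D²` and an upper bound `MD ≥ D²` on the band, a band rate `σb > 0` with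
`xhi²(1 − mD)/4 ≤ σb²(Clo² − 1)` or `σ⋆ ≤ σb`, `e^{8σb} ≤ U ≤ 2Tσb`, `8 ≤ T`, a band weight `Kw` with `xhi²(1 + MD)/4 ≤ Kw(Clo² − 1)`,
and the check `2((U+1)/2)² + 2T²Kw ≤ B²`. [cite: Drazin2002, §8.3 (8.36)–(8.38)] -/
theorem sheet_energy_le_on_band {k β B klo khi xlo xhi Clo Dlo Dhi mD MD σb U T Kw : ℝ}
    (hk1 : klo ≤ k) (hk2 : k ≤ khi) (hklo : 0 < klo)
    (hxlo : xlo ≤ 3.141592 * klo) (hxhi : 3.141593 * khi ≤ xhi) (hxlo0 : 0 < xlo)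
    (hC : Clo ≤ Real.cosh xlo) (hClo : 1 < Clo)
    (hDhi : 2 * Real.sinh xlo / xlo - Real.cosh xlo ≤ Dhi) (hDlo : Dlo ≤ 2 * Real.sinh xhi / xhi - Real.cosh xhi)
    (hmD : mD ≤ 0 ∨ (0 ≤ Dlo ∧ mD ≤ Dlo ^ 2) ∨ (Dhi ≤ 0 ∧ mD ≤ Dhi ^ 2)) (hMD : Dlo ^ 2 ≤ MD ∧ Dhi ^ 2 ≤ MD)
    (hσb : 0 < σb) (hσ : xhi ^ 2 / 4 * (1 - mD) ≤ σb ^ 2 * (Clo ^ 2 - 1) ∨ sawSigmaStar ≤ σb)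
    (hU : Real.exp (8 * σb) ≤ U) (hTU : U ≤ 2 * T * σb) (hT8 : 8 ≤ T)
    (hKw : xhi ^ 2 / 4 * (1 + MD) ≤ Kw * (Clo ^ 2 - 1))
    (hB : 2 * ((U + 1) / 2) ^ 2 + 2 * T ^ 2 * Kw ≤ B ^ 2)
    {p S : ℂ} {m : ℝ} {F : (Fin 2 → ℂ) → (Fin 2 → ℂ)}
    (hp : p = ((π / 2 + 2 * sawSigma0 k β : ℝ) : ℂ)) (hS : S = sawS k β) (hm : m = -sawSigma0 k β)
    (hF : F = fun v => ![I * k * (-p * v 0 - 2 * S * v 1), I * k * (2 * (starRingEnd ℂ) S * v 0 + p * v 1)])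
    {q : ℝ → (Fin 2 → ℂ)} (hq : ∀ θ ∈ Icc (0 : ℝ) 8, HasDerivWithinAt q (F (q θ)) (Icc (0 : ℝ) 8) θ) :
    ∀ θ ∈ Icc (0 : ℝ) 8,
      m * (Complex.normSq (q θ 0) + Complex.normSq (q θ 1)) - 2 * ((starRingEnd ℂ) (q θ 0) * S * q θ 1).re ≤
        B ^ 2 * (m * (Complex.normSq (q 0 0) + Complex.normSq (q 0 1)) - 2 * ((starRingEnd ℂ) (q 0 0) * S * q 0 1).re) := by
  have hπlo := Real.pi_gt_d6
  have hπhi := Real.pi_lt_d6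
  have hπ0 := Real.pi_pos
  have hk : 0 < k := lt_of_lt_of_le hklo hk1
  -- `x = πk ∈ [xlo, xhi]`
  have hx1 : xlo ≤ π * k := by
    have h1 : 3.141592 * klo ≤ π * klo := mul_le_mul_of_nonneg_right hπlo.le hklo.le
    have h2 : π * klo ≤ π * k := mul_le_mul_of_nonneg_left hk1 hπ0.le
    linarith
  have hx2 : π * k ≤ xhi := by
    have h1 : π * k ≤ π * khi := mul_le_mul_of_nonneg_left hk2 hπ0.le
    have h2 : π * khi ≤ 3.141593 * khi := mul_le_mul_of_nonneg_right hπhi.le (hklo.le.trans (hk1.trans hk2))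
    linarith
  have hx0 : 0 < π * k := by positivity
  -- facts about `cosh (πk)` and `D(πk)`, then make them opaque
  have hCxge : Clo ≤ Real.cosh (π * k) := by
    have : Real.cosh xlo ≤ Real.cosh (π * k) := by
      rw [Real.cosh_le_cosh, abs_of_pos hxlo0, abs_of_pos hx0]; exact hx1
    exact hC.trans this
  have hD1 : 2 * Real.sinh (π * k) / (π * k) - Real.cosh (π * k) ≤ Dhi := (khD_le_khD hxlo0 hx1).trans hDhi
  have hD2 : Dlo ≤ 2 * Real.sinh (π * k) / (π * k) - Real.cosh (π * k) := hDlo.trans (khD_le_khD hx0 hx2)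
  have hDC1 : 2 * Real.sinh (π * k) / (π * k) - Real.cosh (π * k) ≤ Real.cosh (π * k) := by
    have h2 : Real.sinh (π * k) ≤ (π * k) * Real.cosh (π * k) := by
      -- termwise on the power series (instance of the tree's `sinh_le_mul_cosh`)
      have e1 := Real.hasSum_sinh (π * k)
      have e2 := (Real.hasSum_cosh (π * k)).mul_left (π * k)
      refine hasSum_le (fun n => ?_) e1 e2
      have hfac : ((2 * n).factorial : ℝ) ≤ ((2 * n + 1).factorial : ℝ) := by exact_mod_cast Nat.factorial_le (by omega)
      have hfpos : (0 : ℝ) < ((2 * n).factorial : ℝ) := by positivity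
      calc (π * k) ^ (2 * n + 1) / ((2 * n + 1).factorial : ℝ)
          ≤ (π * k) ^ (2 * n + 1) / ((2 * n).factorial : ℝ) := div_le_div_of_nonneg_left (by positivity) hfpos hfac
        _ = π * k * ((π * k) ^ (2 * n) / ((2 * n).factorial : ℝ)) := by ring
    have h3 : 2 * Real.sinh (π * k) / (π * k) ≤ 2 * Real.cosh (π * k) := by
      rw [div_le_iff₀ hx0]
      calc 2 * Real.sinh (π * k) ≤ 2 * ((π * k) * Real.cosh (π * k)) := by linarith
        _ = 2 * Real.cosh (π * k) * (π * k) := by ring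
    linarith
  have hDC2 : -Real.cosh (π * k) ≤ 2 * Real.sinh (π * k) / (π * k) - Real.cosh (π * k) := by
    have hs0 : 0 ≤ Real.sinh (π * k) := Real.sinh_nonneg_iff.2 hx0.le
    have h1 : 0 ≤ 2 * Real.sinh (π * k) / (π * k) := by positivity
    linarith
  have hxsq : (π * k) ^ 2 ≤ xhi ^ 2 := pow_le_pow_left₀ hx0.le hx2 2
  have hcos : Real.cos (π * β) ^ 2 ≤ 1 := by rw [sq_le_one_iff_abs_le_one]; exact Real.abs_cos_le_one _
  -- the Bloch-dominated band bounds
  have hWD := sheetW_eq_Dform hk β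
  have hσsq := sawSigma_sq_eq hk β
  generalize hCx : Real.cosh (π * k) = Cx at hCxge hD1 hD2 hDC1 hDC2 hWD hσsq
  generalize hDx : 2 * Real.sinh (π * k) / (π * k) - Cx = Dx at hD1 hD2 hDC1 hDC2 hWD hσsq
  have hDC : Dx ^ 2 ≤ Cx ^ 2 := sq_le_sq' hDC2 hDC1
  have hmDx : mD ≤ Dx ^ 2 := by
    rcases hmD with h | ⟨h1, h2⟩ | ⟨h1, h2⟩
    · exact h.trans (sq_nonneg _)
    · exact h2.trans (pow_le_pow_left₀ h1 hD2 2)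
    · have h3 : Dhi ^ 2 ≤ (-Dx) ^ 2 := sq_le_sq' (by linarith) (by linarith)
      rw [neg_sq] at h3; exact h2.trans h3
  have hMDx : Dx ^ 2 ≤ MD := by
    rcases le_or_gt 0 Dx with h | h
    · exact (pow_le_pow_left₀ h hD1 2).trans hMD.2
    · have h3 : Dx ^ 2 ≤ (-Dlo) ^ 2 := sq_le_sq' (by linarith) (by linarith)
      rw [neg_sq] at h3; exact h3.trans hMD.1
  have hClo2 : 1 < Clo ^ 2 := by nlinarith
  have hCC : Clo ^ 2 ≤ Cx ^ 2 := pow_le_pow_left₀ (by linarith) hCxge 2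
  -- σ ≤ σb
  have hσ0 : 0 ≤ sawSigma k β := mul_nonneg hk.le (Real.sqrt_nonneg _)
  have hσle : sawSigma k β ≤ σb := by
    rcases hσ with hcase | hcase
    · have hsq : sawSigma k β ^ 2 ≤ σb ^ 2 := by
        rw [hσsq]
        exact sigma_core (x2 := (π * k) ^ 2) (by positivity) hxsq hcos hClo2 hCC hDC hmDx hcase
      exact (pow_le_pow_iff_left₀ hσ0 hσb.le two_ne_zero).1 hsq
    · exact (sawSigma_le_sawSigmaStar k β).trans hcase
  -- `k²W ≤ Kw`
  have hkW : k ^ 2 * (π ^ 2 / 4 * (Dx ^ 2 + Real.cos (π * β) ^ 2) / (Cx ^ 2 - Real.cos (π * β) ^ 2)) ≤ Kw := by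
    have e : k ^ 2 * (π ^ 2 / 4 * (Dx ^ 2 + Real.cos (π * β) ^ 2) / (Cx ^ 2 - Real.cos (π * β) ^ 2)) =
        (π * k) ^ 2 / 4 * ((Real.cos (π * β) ^ 2 + Dx ^ 2) / (Cx ^ 2 - Real.cos (π * β) ^ 2)) := by ring
    rw [e]
    exact k2W_core (x2 := (π * k) ^ 2) (by positivity) hxsq hcos hClo2 hCC (sq_nonneg _) hDC hMDx hKw
  -- `sinh (8σ) ≤ Tσ` and `cosh (8σ)² ≤ ((U+1)/2)²`
  obtain ⟨hsinh, hcosh⟩ := sinh_cosh_band hσ0 hσle hσb hU hTU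
  -- conclude through the θ-free reduction
  refine sheet_energy_le_of_sigma_bound (γ := 8) (T := T) hk (by norm_num) hT8 hsinh hp hS hm hF ?_ hq
  rw [hCx, hWD]
  have h1 : 2 * T ^ 2 * k ^ 2 * (π ^ 2 / 4 * (Dx ^ 2 + Real.cos (π * β) ^ 2) / (Cx ^ 2 - Real.cos (π * β) ^ 2)) ≤
      2 * T ^ 2 * Kw := by
    have := mul_le_mul_of_nonneg_left hkW (show 0 ≤ 2 * T ^ 2 by positivity)
    linarith
  linarith

end Summit.AnomalousDissipation.AnomalousDissipation.Theorems.SawtoothPulseCascade.K2PhaseBudget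

end
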